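import Mathlib.LinearAlgebra.Matrix.Charpoly.Coeff
import Mathlib.LinearAlgebra.Trace
import Mathlib.LinearAlgebra.Determinant
import Mathlib.LinearAlgebra.FiniteDimensional.Lemmas
import HarnessLib

/-!
# Rank-two `φ`-modules: `Aut_φ(D)` is transitive on the lines that are not `φ`-stable — the linear
# algebra under «local universality» (U) of crux (R≥)ᵖ (uniqueness of the weakly admissible filtered
# `φ`-module with `φ`-polynomial `X² + 2` and a Hodge line)

Route `ResidualThetaTransportAtTwo` (RTT), crux (R≥)ᵖ `ResidualThetaCountLowerPureAtTwo`
(stmt-BirchSwinnertonDyer-26074); seat `prover-bsd-wall-rtt-p2` g11 (`--supports`, closes nothing).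
HONEST FRAMING: THEOREMS ONLY (no definition, no named fact, no instance, no `sorry`); pure linear
algebra over a field; nothing about `D_cris`, crystalline representations or modular forms is asserted;
BSD is not proved by any of this.

WHY (memo `Cruxes/ResidualThetaCountLowerPureAtTwo/LINE-DESIGN-g11.md` §2 (U1); THETA-LINE-ideator2-r1g5 §1
step 2). Both `V₂W|_{G_ℚ₂}` and `V_λ(g)|_{G_ℚ₂}` are crystalline with Hodge–Tate weights `{0,1}`; their
filtered `φ`-modules are `(D, φ, Fil¹)` with `D` of rank `2` over the coefficient field, `φ` with
characteristic polynomial `X² − a₂X + 2 = X² + 2`, and `Fil¹ ⊂ D` a line which — by weak admissibility —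
is NOT `φ`-stable. The CITED inputs (Fontaine's `D_cris` fully faithful on crystalline representations;
Saito 1997 for the newform; Tate for `W`) reduce «`V_λ(g)|_{G_ℚ₂} ≅ V₂W ⊗ F_λ`» to the statement proved
here: **any two rank-two `φ`-modules with the same characteristic polynomial, each with a chosen
non-`φ`-stable line, are isomorphic by a `φ`-equivariant isomorphism carrying one line to the other** —
whether or not `X² + 2` splits in the coefficient field (no eigenvalue analysis is needed: a vector `v`
spanning a non-stable line gives the cyclic basis `(v, φv)`, in which `φ` is the companion matrix of its
characteristic polynomial).

* `sq_apply_eq_of_linearIndependent` — in the basis `(v, φv)`: `φ²v = −det(φ)·v + tr(φ)·φv`;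
* **`exists_linearEquiv_comp_eq_comp_apply_eq`** — for `φ : V → V`, `ψ : V' → V'` on `2`-dimensional
  spaces with `tr φ = tr ψ`, `det φ = det ψ`, and vectors `v, v'` with `(v, φv)`, `(v', ψv')` linearly
  independent: there is `g : V ≃ V'` with `g ∘ φ = ψ ∘ g` and `g v = v'`;
* `exists_linearEquiv_comp_eq_comp_map_span_eq` — the same, concluding `g(F·v) = F·v'` (lines to lines).

References: the algebra is folklore (rational canonical form in dimension `2`); Colmez–Fontaine 2000
(weakly admissible ⇒ admissible) and Saito 1997 are context only and are NOT used or asserted here.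
-/

set_option autoImplicit false
-- the Theorems namespace of this sub repeats the summit name by design (D-0017 nested layout)
set_option linter.dupNamespace false

noncomputable section

namespace Summit.BirchSwinnertonDyer.BirchSwinnertonDyer.Theorems.ThetaTransport

variable {F : Type*} [Field F] {V V' : Type*} [AddCommGroup V] [Module F V] [AddCommGroup V']
  [Module F V']

/-- In the cyclic basis `(v, φv)` of a `2`-dimensional space, `φ(φv) = −det(φ)·v + tr(φ)·φv`
(the matrix of `φ` is the companion matrix; Cayley–Hamilton in dimension `2`). [folklore] -/
theorem sq_apply_eq_of_linearIndependent (h2 : Module.finrank F V = 2) (φ : V →ₗ[F] V) {v : V}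
    (hv : LinearIndependent F ![v, φ v]) :
    φ (φ v) = (-LinearMap.det φ) • v + (LinearMap.trace F V φ) • φ v := by
  classical
  have hcard : Fintype.card (Fin 2) = Module.finrank F V := by rw [Fintype.card_fin, h2]
  let b : Module.Basis (Fin 2) F V := basisOfLinearIndependentOfCardEqFinrank hv hcard
  have hb0 : b 0 = v := by
    change (basisOfLinearIndependentOfCardEqFinrank hv hcard) 0 = v
    rw [coe_basisOfLinearIndependentOfCardEqFinrank]; rfl
  have hb1 : b 1 = φ v := by
    change (basisOfLinearIndependentOfCardEqFinrank hv hcard) 1 = φ v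
    rw [coe_basisOfLinearIndependentOfCardEqFinrank]; rfl
  -- coordinates of `φ² v`
  set c : Fin 2 →₀ F := b.repr (φ (φ v)) with hc
  have hsum : φ (φ v) = c 0 • v + c 1 • φ v := by
    have := b.sum_repr (φ (φ v))
    rw [Fin.sum_univ_two, hb0, hb1] at this
    exact this.symm
  -- the matrix of `φ` in the basis `b`
  have hM : ∀ i j, LinearMap.toMatrix b b φ i j = b.repr (φ (b j)) i := fun i j =>
    LinearMap.toMatrix_apply b b φ i j
  have h00 : LinearMap.toMatrix b b φ 0 0 = 0 := by
    rw [hM, hb0, ← hb1, b.repr_self]; simp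
  have h10 : LinearMap.toMatrix b b φ 1 0 = 1 := by
    rw [hM, hb0, ← hb1, b.repr_self]; simp
  have h01 : LinearMap.toMatrix b b φ 0 1 = c 0 := by rw [hM, hb1]
  have h11 : LinearMap.toMatrix b b φ 1 1 = c 1 := by rw [hM, hb1]
  have htr : LinearMap.trace F V φ = c 1 := by
    rw [LinearMap.trace_eq_matrix_trace F b φ, Matrix.trace_fin_two, h00, h11, zero_add]
  have hdet : LinearMap.det φ = - c 0 := by
    rw [← LinearMap.det_toMatrix b, Matrix.det_fin_two, h00, h11, h01, h10]; ring
  rw [hsum, htr, hdet, neg_neg]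

/-- **`Aut_φ` is transitive on non-`φ`-stable lines, across two models**: if `φ : V → V` and
`ψ : V' → V'` are endomorphisms of `2`-dimensional spaces with the same trace and determinant (same
characteristic polynomial) and `v ∈ V`, `v' ∈ V'` span lines that are not stable (`(v, φv)` and
`(v', ψv')` linearly independent), then some isomorphism `g : V ≃ V'` satisfies `g ∘ φ = ψ ∘ g` and
`g v = v'`. [folklore] -/
theorem exists_linearEquiv_comp_eq_comp_apply_eq (h2 : Module.finrank F V = 2)
    (h2' : Module.finrank F V' = 2) (φ : V →ₗ[F] V) (ψ : V' →ₗ[F] V')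
    (htr : LinearMap.trace F V φ = LinearMap.trace F V' ψ) (hdet : LinearMap.det φ = LinearMap.det ψ)
    {v : V} {v' : V'} (hv : LinearIndependent F ![v, φ v]) (hv' : LinearIndependent F ![v', ψ v']) :
    ∃ g : V ≃ₗ[F] V', g.toLinearMap ∘ₗ φ = ψ ∘ₗ g.toLinearMap ∧ g v = v' := by
  classical
  have hcard : Fintype.card (Fin 2) = Module.finrank F V := by rw [Fintype.card_fin, h2]
  have hcard' : Fintype.card (Fin 2) = Module.finrank F V' := by rw [Fintype.card_fin, h2']
  let b : Module.Basis (Fin 2) F V := basisOfLinearIndependentOfCardEqFinrank hv hcard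
  let b' : Module.Basis (Fin 2) F V' := basisOfLinearIndependentOfCardEqFinrank hv' hcard'
  have hb : ∀ i, b i = ![v, φ v] i := fun i => by
    change (basisOfLinearIndependentOfCardEqFinrank hv hcard) i = _
    rw [coe_basisOfLinearIndependentOfCardEqFinrank]
  have hb' : ∀ i, b' i = ![v', ψ v'] i := fun i => by
    change (basisOfLinearIndependentOfCardEqFinrank hv' hcard') i = _
    rw [coe_basisOfLinearIndependentOfCardEqFinrank]
  let g : V ≃ₗ[F] V' := b.equiv b' (Equiv.refl _)
  have hg : ∀ i, g (b i) = b' i := fun i => by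
    change b.equiv b' (Equiv.refl _) (b i) = b' i
    rw [Module.Basis.equiv_apply]; rfl
  have hgv : g v = v' := by
    have := hg 0
    rw [hb 0, hb' 0] at this
    exact this
  have hgφv : g (φ v) = ψ v' := by
    have := hg 1
    rw [hb 1, hb' 1] at this
    exact this
  refine ⟨g, ?_, hgv⟩
  apply b.ext
  intro i
  rw [LinearMap.comp_apply, LinearMap.comp_apply]
  change g (φ (b i)) = ψ (g (b i))
  fin_cases i
  · change g (φ (b 0)) = ψ (g (b 0))
    rw [hb 0]
    change g (φ v) = ψ (g v)
    rw [hgφv, hgv]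
  · change g (φ (b 1)) = ψ (g (b 1))
    rw [hb 1]
    change g (φ (φ v)) = ψ (g (φ v))
    rw [sq_apply_eq_of_linearIndependent h2 φ hv, map_add, map_smul, map_smul, hgv, hgφv, htr, hdet]
    exact (sq_apply_eq_of_linearIndependent h2' ψ hv').symm

/-- The same, stated on LINES: a `φ`-equivariant isomorphism carrying the non-stable line `F·v` onto
the non-stable line `F·v'` (the «Hodge line» form used for filtered `φ`-modules of rank `2`).
[folklore] -/
theorem exists_linearEquiv_comp_eq_comp_map_span_eq (h2 : Module.finrank F V = 2)
    (h2' : Module.finrank F V' = 2) (φ : V →ₗ[F] V) (ψ : V' →ₗ[F] V')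
    (htr : LinearMap.trace F V φ = LinearMap.trace F V' ψ) (hdet : LinearMap.det φ = LinearMap.det ψ)
    {v : V} {v' : V'} (hv : LinearIndependent F ![v, φ v]) (hv' : LinearIndependent F ![v', ψ v']) :
    ∃ g : V ≃ₗ[F] V', g.toLinearMap ∘ₗ φ = ψ ∘ₗ g.toLinearMap ∧
      (Submodule.span F {v}).map g.toLinearMap = Submodule.span F {v'} := by
  obtain ⟨g, hg, hgv⟩ := exists_linearEquiv_comp_eq_comp_apply_eq h2 h2' φ ψ htr hdet hv hv'
  refine ⟨g, hg, ?_⟩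
  rw [Submodule.map_span, Set.image_singleton]
  change Submodule.span F {g v} = _
  rw [hgv]

end Summit.BirchSwinnertonDyer.BirchSwinnertonDyer.Theorems.ThetaTransport

end
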